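import Summits.BirchSwinnertonDyer.Rank1Residual.Additive.QuadraticTwistTowerNoPTorsion
import Literature.NumberTheory.EllipticCurves.SelmerRestrictionCorank
import Mathlib.GroupTheory.PGroup
import HarnessLib

/-!
# `#Sel^{loc,∞}(E/K) = p^{ord_p f(0)}`: the Selmer group over `K` of the LEVEL-`∞` signed conditions
# is FINITE of order exactly `|f(0)|_p⁻¹` (cell `b2b-bsdres`, CLASS-CLOSURE lane, class O10 — x1b
# GEN 36, class lead; file 59 of the series: B1 ⊕ B2 (files 42–49, 55) in Greenberg's one-term shape
# `#Sel_E(ℚ_∞)^Γ ∼ f_E(0)`)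

HONEST FRAMING (cell `b2b-bsdres`, run/shared/lean/b2b/bsd-rank1-residual/, verbatim in every
file): the goal of the cell is to DELETE the COMBINATION-SHAPED residual classes of the
Birch–Swinnerton-Dyer formula for ALL analytic-rank `≤ 1` elliptic curves over `ℚ` — "full BSD
formula for every rank `≤ 1` curve in class `C`" assembled STRICTLY from published theorems — so
that the rank-`≤ 1` remainder becomes exactly the CONSTRUCTION-SHAPED classes, which are TYPED
(missing-input `Prop`s), NOT attempted. This is not "finishing BSD". CLASS-CLOSURE lane: prove
what is provable now; shrink each hard class to its core with data; no claim beyond stated classes;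
research routes on CONSTRUCTION-SHAPED X12 / O10; census / instrument output = EVIDENCE / conjecture
items, NEVER a Literature fact; `RESIDUAL-MAP.md` marks change only by signed lines. THIS FILE:
TOOL THEOREMS ONLY — no definition, no named Literature fact, no Summits-side fact `def … : Prop`,
no `sorry`, axioms standard; nothing is booked; no label / mark / count / sub-cell moves; (C1_η),
(C2_η-GZ), (C3_η) stay typed as filed (cc-typer-6's pen); O10 stays OPEN / CONSTRUCTION-SHAPED;
nothing about `BSD(W, p)` of any pair is claimed.

## What

B1 ⊕ B2 (`StrictSignedControlZero.finite_and_padicValNat_card_localPreimage_add_eq`, file 49) says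
`ord_p #S₀ + ord_p #(A₀ ⧸ S₀) = ord_p f(0)` for `S₀ = Sel^{ε,str}(E/K_0)` and `A₀ = Sel^{loc,∞}(E/K)`,
the group of classes over `K` satisfying the LEVEL-`∞` local conditions. Since `S₀ ≤ A₀`
(`map_layerToInfty_strictSignedSelmerLayer_le` + `comap_layerToInfty_zero_strictSignedSelmerInfty_eq`)
and `H¹(K, E[p^∞])` is `p`-primary (`exists_pow_nsmul_eq_zero_subgroupH1`: `Γ_K` compact, `E[p^∞]`
`p`-primary), this is ONE statement about ONE finite `p`-group:

* `finite_localPreimage_and_natCard_eq` — under the hypotheses of file 49 (any `K`, `κ`, model `E`,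
  sign `ε`; (hS), (htors), (hB); dual datum with `X` f.g. torsion, no finite submodule,
  `char = (f)`, `f(0) ≠ 0`): **`Sel^{loc,∞}(E/K)` is finite, `#Sel^{loc,∞}(E/K) = #S₀ · #(A₀ ⧸ S₀)`,
  and `#Sel^{loc,∞}(E/K) = p ^ ord_p f(0)`** — Greenberg's `#Sel_E(ℚ_∞)^Γ_p = |f_E(0)|_p⁻¹` shape
  (LNM 1716 §4, Thm. 4.1 / Lemma 4.2 with [K] Lemma 9.1: `h₀ : A₀ ≅ Sel^{ε,str}(E/K_∞)^Γ`) for the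
  strict signed structure, and the form the stabilisation step of the count (C) consumes (`A₀`
  finite of known order ⇒ `A₀ = A₀[p^n]` for `n ≥ ord_p f(0)`).
* `finite_localPreimage_and_natCard_eq_of_quadraticTwist_signedPrime` — the same for the `p*`-TWIST
  `W` of a globally minimal good `a_p = 0` curve over `K = ℚ`, `E = ℚ_p`, with (hS), (htors), (hB)
  DISCHARGED (file 55): hypothesis-free besides the dual datum.

References: [GreenbergLNM1716] R. Greenberg, LNM 1716 (1999), §4 Thm. 4.1 and Lemma 4.2 (p. 102);
[Kobayashi2003] Lemma 9.1 (p. 25), Thm. 9.3 (p. 26).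
-/

noncomputable section

open scoped Classical

open NumberField IsDedekindDomain WeierstrassCurve Literature.NumberTheory.EllipticCurves
  Literature.NumberTheory.GaloisRepresentations Literature.NumberTheory.EllipticCurves.IwasawaAlgebra
  Literature.NumberTheory.EllipticCurves.IwasawaDual Literature.NumberTheory.EllipticCurves.Kobayashi2003
  ZpExtension

universe u

namespace Summit.BirchSwinnertonDyer.Rank1Residual.Additive

namespace StrictSignedControlZero

/-! ## §1 `#Sel^{loc,∞}(E/K) = p^{ord_p f(0)}` -/

section General

variable {K : Type u} [Field K] [NumberField K] (W : WeierstrassCurve K) {p : ℕ} [hp : Fact p.Prime]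
  (κ : ZpExtension K p) (E : Type u) [Field E] [Algebra K E] (ε : ℤˣ)

/-- **`Sel^{loc,∞}(E/K)` is a finite `p`-group of order `p^{ord_p f(0)}`**, and
`#Sel^{loc,∞}(E/K) = #Sel^{ε,str}(E/K) · #(Sel^{loc,∞}(E/K) ⧸ Sel^{ε,str}(E/K))` — B1 ⊕ B2 (file 49) as
a one-term count: the classes over `K` whose restriction to `K_∞` satisfies the level-`∞` local
conditions form a group of order EXACTLY `|f(0)|_p⁻¹` (Greenberg's `#Sel(ℚ_∞)^Γ_p ∼ f(0)`, the
control map `h₀` being bijective onto the `Γ`-invariants by [K] Lemma 9.1). Hypotheses as in file 49.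
[cite: GreenbergLNM1716, §4 Thm. 4.1 and Lemma 4.2 (p. 102)] [cite: Kobayashi2003, Lemma 9.1 (p. 25), Thm. 9.3 (p. 26)] -/
theorem finite_localPreimage_and_natCard_eq [W.IsElliptic]
    {γ : Field.absoluteGaloisGroup K} (hγ : κ.IsTopGenerator γ) (D : StrictSignedSelmerDualData W κ E γ ε)
    [Module.Finite (IwasawaAlgebra p) D.X] (hX : Module.IsTorsion (IwasawaAlgebra p) D.X)
    (hB : FixedPoints.addSubgroup κ.kerSubgroup (W.geomPrimaryTorsion p) = ⊥)
    (hnf : ∀ N : Submodule (IwasawaAlgebra p) D.X, Finite N → N = ⊥)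
    {f : IwasawaAlgebra p} (hf : D.charIdeal = Ideal.span {f})
    (h0 : PowerSeries.constantCoeff f ≠ 0)
    (S : Finset (HeightOneSpectrum (𝓞 K)))
    (hS : ∀ v ∉ S, (p : 𝓞 K) ∉ v.asIdeal ∧ W.HasGoodReductionAt v)
    (htors : ∀ P : localPoints W E, P ∈ localFixedPointsOfEmb (closureEmb (K := K) E) W κ.kerSubgroup →
      (∃ j : ℕ, p ^ j • P = 0) → P = 0) :
    Finite (↥((W.selmerInfty κ ⊓
          ⨅ σ : Field.absoluteGaloisGroup K,
            (localKummerOverOfEmb W p κ.kerSubgroup (closureEmb (K := K) E)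
                (⨆ m, strictSignedLocalPoints κ E W ε m)).comap (W.conjH1 p κ.kerSubgroup σ)).comap
          (W.layerToInfty κ 0))) ∧
      Nat.card (↥((W.selmerInfty κ ⊓
          ⨅ σ : Field.absoluteGaloisGroup K,
            (localKummerOverOfEmb W p κ.kerSubgroup (closureEmb (K := K) E)
                (⨆ m, strictSignedLocalPoints κ E W ε m)).comap (W.conjH1 p κ.kerSubgroup σ)).comap
          (W.layerToInfty κ 0))) =
        Nat.card (strictSignedSelmerLayer W κ E ε 0) *
          Nat.card (↥((W.selmerInfty κ ⊓
            ⨅ σ : Field.absoluteGaloisGroup K,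
              (localKummerOverOfEmb W p κ.kerSubgroup (closureEmb (K := K) E)
                  (⨆ m, strictSignedLocalPoints κ E W ε m)).comap (W.conjH1 p κ.kerSubgroup σ)).comap
            (W.layerToInfty κ 0)) ⧸
          (strictSignedSelmerLayer W κ E ε 0).addSubgroupOf ((W.selmerInfty κ ⊓
            ⨅ σ : Field.absoluteGaloisGroup K,
              (localKummerOverOfEmb W p κ.kerSubgroup (closureEmb (K := K) E)
                  (⨆ m, strictSignedLocalPoints κ E W ε m)).comap (W.conjH1 p κ.kerSubgroup σ)).comap
            (W.layerToInfty κ 0))) ∧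
      Nat.card (↥((W.selmerInfty κ ⊓
          ⨅ σ : Field.absoluteGaloisGroup K,
            (localKummerOverOfEmb W p κ.kerSubgroup (closureEmb (K := K) E)
                (⨆ m, strictSignedLocalPoints κ E W ε m)).comap (W.conjH1 p κ.kerSubgroup σ)).comap
          (W.layerToInfty κ 0))) =
        p ^ (((PowerSeries.constantCoeff f : ℤ_[p]) : ℚ_[p]).valuation).toNat := by
  obtain ⟨hfinS, hfinQ, heq⟩ := finite_and_padicValNat_card_localPreimage_add_eq W κ E ε hγ D hX hB
    hnf hf h0 S hS htors
  set A := (W.selmerInfty κ ⊓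
      ⨅ σ : Field.absoluteGaloisGroup K,
        (localKummerOverOfEmb W p κ.kerSubgroup (closureEmb (K := K) E)
            (⨆ m, strictSignedLocalPoints κ E W ε m)).comap (W.conjH1 p κ.kerSubgroup σ)).comap
      (W.layerToInfty κ 0) with hA
  set S0 := strictSignedSelmerLayer W κ E ε 0 with hS0
  -- `S₀ ≤ A₀`
  have hle : S0 ≤ A := by
    rw [hA, ← comap_layerToInfty_zero_strictSignedSelmerInfty_eq W κ E ε S hS htors]
    intro y hy
    rw [AddSubgroup.mem_comap]
    exact map_layerToInfty_strictSignedSelmerLayer_le W κ E ε 0 ⟨y, hy, rfl⟩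
  have hcardS : Nat.card (S0.addSubgroupOf A) = Nat.card S0 :=
    Nat.card_congr (AddSubgroup.addSubgroupOfEquivOfLe hle).toEquiv
  have hmul : Nat.card A = Nat.card S0 * Nat.card (A ⧸ S0.addSubgroupOf A) := by
    rw [AddSubgroup.card_eq_card_quotient_mul_card_addSubgroup (S0.addSubgroupOf A), hcardS, mul_comm]
  haveI := hfinS
  haveI := hfinQ
  have hposS : 0 < Nat.card S0 := Nat.card_pos
  have hposQ : 0 < Nat.card (A ⧸ S0.addSubgroupOf A) := Nat.card_pos
  have hcardA : Nat.card A ≠ 0 := by rw [hmul]; exact (Nat.mul_pos hposS hposQ).ne'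
  haveI hfinA : Finite A := Nat.finite_of_card_ne_zero hcardA
  -- `A₀` is a `p`-group (`H¹(K, E[p^∞])` is `p`-primary)
  haveI : CompactSpace (Field.absoluteGaloisGroup K) := compactSpace_absoluteGaloisGroup K
  have hM : ∀ m : W.geomPrimaryTorsion p, ∃ k : ℕ, p ^ k • m = 0 := fun m ↦ by
    obtain ⟨k, hk⟩ := AddCommGroup.mem_primaryComponent.mp m.2
    exact ⟨k, Subtype.ext (by rw [AddSubmonoidClass.coe_nsmul, hk, ZeroMemClass.coe_zero])⟩
  have hprim : ∀ a : A, ∃ k : ℕ, p ^ k • a = 0 := fun a ↦ by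
    obtain ⟨k, hk⟩ := exists_pow_nsmul_eq_zero_subgroupH1 (κ.layerSubgroup 0)
      (Subgroup.isClosed_of_isOpen _ (κ.isOpen_layerSubgroup 0)) hM
      (a : W.subgroupH1 p (κ.layerSubgroup 0))
    exact ⟨k, Subtype.ext (by rw [AddSubmonoidClass.coe_nsmul, hk, ZeroMemClass.coe_zero])⟩
  obtain ⟨m, hm⟩ : ∃ m : ℕ, Nat.card A = p ^ m := by
    have hG : IsPGroup p (Multiplicative A) := fun x ↦ by
      obtain ⟨k, hk⟩ := hprim (Multiplicative.toAdd x)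
      refine ⟨k, ?_⟩
      apply Multiplicative.toAdd.injective
      rw [toAdd_pow, toAdd_one]
      exact hk
    obtain ⟨m, hm⟩ := IsPGroup.iff_card.mp hG
    exact ⟨m, by rw [← hm]; exact (Nat.card_congr Multiplicative.toAdd).symm⟩
  -- compare valuations
  have hval : (padicValNat p (Nat.card A) : ℤ) =
      ((PowerSeries.constantCoeff f : ℤ_[p]) : ℚ_[p]).valuation := by
    rw [hmul, padicValNat.mul hposS.ne' hposQ.ne', Nat.cast_add]
    exact heq
  have hvm : padicValNat p (Nat.card A) = m := by rw [hm, padicValNat.prime_pow]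
  refine ⟨hfinA, hmul, ?_⟩
  rw [hm]
  congr 1
  rw [← hval, hvm, Int.toNat_natCast]

end General

/-! ## §2 For the `p*`-twist of a good supersingular curve, hypothesis-free -/

section Twist

variable {p : ℕ} [hp : Fact p.Prime] (κ : ZpExtension ℚ p) (W : WeierstrassCurve ℚ) [W.IsElliptic]
  (ε : ℤˣ)

/-- **`#Sel^{loc,∞}(W/ℚ) = p^{ord_p f(0)}` for the `p*`-TWIST `W` of a globally minimal good `a_p = 0`
curve `V`** (`C • W.quadraticTwist ((−1)^{p/2} p) = V`, `V.HasGoodReductionAtPrime p`,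
`V.frobeniusTrace p = 0`, `p ≥ 3`): `Sel^{loc,∞}(W/ℚ)` is finite,
`#Sel^{loc,∞}(W/ℚ) = #Sel^{ε,str}(W/ℚ) · #(Sel^{loc,∞}(W/ℚ) ⧸ Sel^{ε,str}(W/ℚ))` and
`#Sel^{loc,∞}(W/ℚ) = p^{ord_p f(0)}` with NO hypothesis besides the strict signed dual datum — §1 with
(hS), (htors), (hB) discharged by file 55. For `κ` cyclotomic, `ε = −1` this is the object of the
(C3_η) derivation. [cite: GreenbergLNM1716, §4 Thm. 4.1 and Lemma 4.2 (p. 102)]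
[cite: Kobayashi2003, Prop. 8.7 (p. 16), Lemma 9.1 (p. 25), Thm. 9.3 (p. 26)] -/
theorem finite_localPreimage_and_natCard_eq_of_quadraticTwist_signedPrime (hp2 : p ≠ 2)
    (C : VariableChange ℚ) (V : WeierstrassCurve ℚ) [V.IsElliptic] [V.IsGloballyMinimal]
    (hCV : C • W.quadraticTwist ((-1) ^ (p / 2) * p) = V)
    (hgood : V.HasGoodReductionAtPrime p) (hap : V.frobeniusTrace p = 0)
    {γ : Field.absoluteGaloisGroup ℚ} (hγ : κ.IsTopGenerator γ)
    (D : StrictSignedSelmerDualData W κ ℚ_[p] γ ε)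
    [Module.Finite (IwasawaAlgebra p) D.X] (hX : Module.IsTorsion (IwasawaAlgebra p) D.X)
    (hnf : ∀ N : Submodule (IwasawaAlgebra p) D.X, Finite N → N = ⊥)
    {f : IwasawaAlgebra p} (hf : D.charIdeal = Ideal.span {f})
    (h0 : PowerSeries.constantCoeff f ≠ 0) :
    Finite (↥((W.selmerInfty κ ⊓
          ⨅ σ : Field.absoluteGaloisGroup ℚ,
            (localKummerOverOfEmb W p κ.kerSubgroup (closureEmb (K := ℚ) ℚ_[p])
                (⨆ m, strictSignedLocalPoints κ ℚ_[p] W ε m)).comap (W.conjH1 p κ.kerSubgroup σ)).comap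
          (W.layerToInfty κ 0))) ∧
      Nat.card (↥((W.selmerInfty κ ⊓
          ⨅ σ : Field.absoluteGaloisGroup ℚ,
            (localKummerOverOfEmb W p κ.kerSubgroup (closureEmb (K := ℚ) ℚ_[p])
                (⨆ m, strictSignedLocalPoints κ ℚ_[p] W ε m)).comap (W.conjH1 p κ.kerSubgroup σ)).comap
          (W.layerToInfty κ 0))) =
        Nat.card (strictSignedSelmerLayer W κ ℚ_[p] ε 0) *
          Nat.card (↥((W.selmerInfty κ ⊓
            ⨅ σ : Field.absoluteGaloisGroup ℚ,
              (localKummerOverOfEmb W p κ.kerSubgroup (closureEmb (K := ℚ) ℚ_[p])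
                  (⨆ m, strictSignedLocalPoints κ ℚ_[p] W ε m)).comap (W.conjH1 p κ.kerSubgroup σ)).comap
            (W.layerToInfty κ 0)) ⧸
          (strictSignedSelmerLayer W κ ℚ_[p] ε 0).addSubgroupOf ((W.selmerInfty κ ⊓
            ⨅ σ : Field.absoluteGaloisGroup ℚ,
              (localKummerOverOfEmb W p κ.kerSubgroup (closureEmb (K := ℚ) ℚ_[p])
                  (⨆ m, strictSignedLocalPoints κ ℚ_[p] W ε m)).comap (W.conjH1 p κ.kerSubgroup σ)).comap
            (W.layerToInfty κ 0))) ∧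
      Nat.card (↥((W.selmerInfty κ ⊓
          ⨅ σ : Field.absoluteGaloisGroup ℚ,
            (localKummerOverOfEmb W p κ.kerSubgroup (closureEmb (K := ℚ) ℚ_[p])
                (⨆ m, strictSignedLocalPoints κ ℚ_[p] W ε m)).comap (W.conjH1 p κ.kerSubgroup σ)).comap
          (W.layerToInfty κ 0))) =
        p ^ (((PowerSeries.constantCoeff f : ℤ_[p]) : ℚ_[p]).valuation).toNat := by
  obtain ⟨M, hΔ, hA, hVM⟩ := exists_goodSupersingularPadicModel hp2 V hgood hap
  obtain ⟨S, hS⟩ := exists_finset_forall_not_mem_good W p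
  have hc := sq_ne_neg_one_pow_mul_prime hp.out (p / 2)
  exact finite_localPreimage_and_natCard_eq W κ ℚ_[p] ε hγ D hX
    (fixedPoints_kerSubgroup_geomPrimaryTorsion_eq_bot_of_quadraticTwist κ hp2 W hc C hCV M hΔ hA hVM)
    hnf hf h0 S hS
    (eq_zero_of_prime_pow_smul_eq_zero_localFixedPointsOfEmb_kerSubgroup_of_quadraticTwist κ
      (closureEmb (K := ℚ) ℚ_[p]) hp2 W hc C hCV M hΔ hA hVM)

end Twist

end StrictSignedControlZero

end Summit.BirchSwinnertonDyer.Rank1Residual.Additive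

end
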